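import Summits.Ventures.QEC.CircuitDistance.SchedComposition
import Summits.Ventures.QEC.CircuitDistance.SchedTablesBB144o345
import Summits.Ventures.QEC.CircuitDistance.SchedCoverBase
import HarnessLib

/-!
# Q4 lane, ₛ-spine (top): the DATA-FACING binders of the `#345` word — the two sector exclusions at `N₀ = w = 10` from tables,
# leaves and list completeness (venture QEC, experiment cell CDX, seat qec-cdx-type-2; director-qec
# R156 (2) / R158 (1); IMPLICATIONS ONLY — nothing here asserts a value of `d_circ`; the two hypotheses are what the `o345` tables
# (`SchedTablesBB144o345`), the 246 `X`-sector leaves (qec-cdx-eng-1), the W = 10 list-completeness tower and the transport lemma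
# (qec-cdx-idea-1) discharge through `no_xLogical_of_leavesCₛ` / `no_zLogical_of_leavesCₛ`)

* **`sched345_no_xLogical_of_leaves`** / **`sched345_no_zLogical_of_leaves`**: the two SECTOR EXCLUSIONS of `SchedComposition`'s
  `sched345_circuitDistance_eq_eleven_of_sectors` / `not_CDX_Q4_345_of_sectors`, in DATA-FACING form — from the kernel-certified `o345`
  tables, a list of covered / well-formed / UNREALISED leaves of weight `10`, budget `≤ 1`, and class-word completeness up to translation
  (`no_xLogical_of_leavesCₛ` at `(σ, S, T, N₀, w) = (sched345, bb144SM, o345XTable, 10, 10)`).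
Hygiene of record (R151 (4)): the sector facts are UNDECIDED in the kernel today (SOLVER/ENUMERATION ×2 at model level); variant numbering
ours (`orders936.json[345]`, criterion O1; RIDER L).
-/

namespace Summit.Ventures.QEC.CircuitDistance

open Literature.InformationTheory.QuantumCodes

/-- The `X`-sector exclusion from DATA: the `o345` table (shape-correct for `sched345`, class-correct), a list of covered, well-formed,
UNREALISED leaves of weight `10` and budget `≤ 1`, and COMPLETENESS of that list up to translation for `X`-nontrivial class-words of
weight `≤ 10` (the W = 10 tower's output) — the exact binder the Q4 data files discharge. -/
theorem sched345_no_xLogical_of_leaves (leaves : List (LeafEntry 12 6))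
    (hwf : ∀ e ∈ leaves, e.leaf.wf = true ∧ Fibre.Covers₀ (xDEMₛ sched345 bb144SM o345XTable 10) (scope 10) encDet e.word e.leaf ∧
      e.word.Nodup ∧ e.leaf.w = 10 ∧ e.leaf.budget ≤ 1 ∧ ¬ e.leaf.Realised)
    (hcomplete : ∀ x : Finset (Finset (BB.Mono 12 6 ⊕ BB.Mono 12 6)), (∀ g ∈ x, IsXClass o345XTable g) →
      XNontrivial bb144SM (∑ g ∈ x, indic g) → x.card ≤ 10 →
        ∃ e ∈ leaves, ∃ t : BB.Mono 12 6, x = (e.word.map (trQ t)).toFinset) :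
    ¬ ∃ F : Finset (Fault 12 6), Gen.Undetectable bb144SM 10 (allEventsₛ sched345 10) F ∧
      Gen.dataX bb144SM (allEventsₛ sched345 10) F ∉ rowSpace bb144SM.toCode.HX ∧ faultCount F ≤ 10 :=
  no_xLogical_of_leavesCₛ (sched345_cycleFacts bb144SM) o345XTable o345XTable_shapeCorrect o345XTable_classCorrect 10 10 leaves
    hwf hcomplete

/-- The `Z`-sector exclusion from DATA (mirror; alternatively obtained from the `X` sector by the transport lemma). -/
theorem sched345_no_zLogical_of_leaves (leaves : List (LeafEntry 12 6))
    (hwf : ∀ e ∈ leaves, e.leaf.wf = true ∧ Fibre.Covers₀ (zDEMₛ sched345 bb144SM o345ZTable 10) (scope 10) encDet e.word e.leaf ∧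
      e.word.Nodup ∧ e.leaf.w = 10 ∧ e.leaf.budget ≤ 1 ∧ ¬ e.leaf.Realised)
    (hcomplete : ∀ x : Finset (Finset (BB.Mono 12 6 ⊕ BB.Mono 12 6)), (∀ g ∈ x, IsZClass o345ZTable g) →
      ZNontrivial bb144SM (∑ g ∈ x, indic g) → x.card ≤ 10 →
        ∃ e ∈ leaves, ∃ t : BB.Mono 12 6, x = (e.word.map (trQ t)).toFinset) :
    ¬ ∃ F : Finset (Fault 12 6), Gen.Undetectable bb144SM 10 (allEventsₛ sched345 10) F ∧
      Gen.dataZ bb144SM (allEventsₛ sched345 10) F ∉ rowSpace bb144SM.toCode.HZ ∧ faultCount F ≤ 10 :=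
  no_zLogical_of_leavesCₛ (sched345_cycleFacts bb144SM) o345ZTable o345ZTable_shapeCorrect o345ZTable_classCorrect 10 10 leaves
    hwf hcomplete

end Summit.Ventures.QEC.CircuitDistance
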